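import Literature.MathematicalPhysics.QuantumFieldTheory.Balaban1983to89.Node00.OpsYSectDReal

/-!
# `Balaban1983to89.Node00.OpsYD2JForm` — [B9] (3.156): the Sect. E letter `D2J(U)` of def-Y's record (the operator of the quadratic form
# `B ↦ 2⟨H₁D̃⁽²⁾(B), J⟩`) AS A FUNCTION of [5]-type's second-order form `D̃⁽²⁾` and def-Y's `H₁` (3.129), and the v8 instance of record `opsYOfRecordV8E`

T. Bałaban, *Propagators for lattice gauge theories in a background field*, Commun. Math. Phys. **99** (1985) 389–434
[`Balaban1985BackgroundPropagators`, "B9"]; [5] = T. Bałaban, *Averaging operations for lattice gauge theories*, Commun. Math. Phys. **98** (1985) 17–51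
[`Balaban1985Averaging`, "B7"]; T. Bałaban, *The variational problem and background fields in renormalization group method for lattice gauge
theories*, Commun. Math. Phys. **102** (1985) 277–309 [`Balaban1985Variational`, "B11"] for the polarised notation of a quadratic Taylor term (p. 286 after
(56): *"C_j⁽²⁾(A′, A″) denotes a symmetric bilinear form obtained by polarization from the quadratic form C⁽²⁾(A′)"*).

statement-level skeleton of published theorems with citation tags; proofs where landed; nothing here is a claim about the
Yang–Mills mass gap

THE PRINTED LOCI (pp. 427–428, read from the text layer `paper:balaban1985-cmp99-background-propagators` pp. 39–40 and the page images).
p. 427, after (3.155): *"where the operators are defined by the sequence {Ω_j} and a configuration U satisfying (3.35), (3.36), the function D̃⁽²⁾(B) is a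
quadratic polynomial in B with properties similar to C⁽²⁾(A), only restricted to unit blocks, and g is an arbitrary Lie algebra valued function defined at
bonds of Λ. The quadratic form in the above integral can be written also as"* (here «C⁽²⁾(A)» is the second-order function of the FIELD `A` of (3.127)
p. 421 — the [B9] page owner's reading of the printed letter, lit-balaban-r06) — p. 428, (3.156): *"⟨B,(QG₁Q\*)⁻¹B⟩ − a⟨B,B⟩ − 2⟨H₁D̃⁽²⁾(B),J⟩ = ⟨B,Δ_kB⟩."*
— *"This form is considered on the subspace {B : B = 0 on Λᶜ, B = 0 on ⋃_{y∈Λ′}Ax(y), Q₁B = 0}."*; p. 427 (end of Sect. D): *"We have the same situation for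
the operators H₁."* (the random-walk expansion of `Δ⁽²⁾` ∕ `H` ∕ `H₁` with tree-like `ω`); p. 421, (3.129): `H₁ = G₁Q\*(QG₁Q\*)⁻¹` (def-Y's `H1Y`); p. 419 after
(3.117): *"the function J = D\*η⁻²Im ∂U is small, if U satisfies the condition (3.36)"* (r06's `B9Eq39Adjoint.J`, NODE 00's `JY` of `Node00.OpsYDelta2Form`).

WHY THIS FILE (def-Y's located gap (O3c) of `OPS-LETTERS-CONSTRUCTION.md` §9′; the twin of FILE 20 `Node00.OpsYDelta2Form` one section later).  In the
record `opsYOfRecordV7E N θ M⋆ 𝔠 𝔢₀ 𝔴 𝔈` the Sect. E letter `(𝔢₀ x).D2J : IBondOpY` — *«the operator of the form B ↦ 2⟨H₁D̃⁽²⁾(B), J⟩ in (3.156)»*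
(`Node00.OpsYSectE.SectELettersY`) — is a bare PARAMETER carrying one axiom, its `U = 1` clause `D2J_one`.  Exactly as (3.134)'s `Δ⁽²⁾` was for [5]'s
`C⁽²⁾`, (3.156)'s `J`-term is *the operator of a quadratic form* built from THREE objects of which two ARE in NODE 00's tree: def-Y's `H₁ = H1Y` (3.129)
(`Node00.OpsYSectDE`, over the residual letter `Δ⁽²⁾`) and r06's current `J` (`JY`, with `JY_one'`: `∂U = 1 ⇒ Im ∂U = 0 ⇒ J = 0`).  So `D2J(U)` can be TYPED
AS PRINTED: a definite FUNCTION `d2JOfY` of the one genuinely external letter, the unit-lattice second-order form `D̃⁽²⁾` («a quadratic polynomial in B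
with properties similar to C⁽²⁾(A), only restricted to unit blocks» — [5]'s construction, NOT an object of NODE 00's tree: the letter `Dt2LettersY`, flat
witness only).  This file does that with FILE 20's trace-dual machinery BY NAME (`trPairY`, `TrDualY`, `trDualMatY`, `rieszY`, `trAdjY`, `JY`,
`trPairY_polarize`, `JY_gaugeY`, `conjY_rieszY_comp_conjY`, `star_JY`), proves the defining identity (3.156)'s `J`-term polarised and verbatim, its `H₁†`
form, UNIQUENESS, the `U = 1` clause `D2J(1) = 0` as a THEOREM (`J(1) = 0`; no hypothesis on `Δ⁽²⁾`), `τ`-symmetry, reality at a unitary background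
modulo the reality of the two form letters `D̃⁽²⁾(U)` and `Δ⁽²⁾(U)` (FILE 21's `H1Y_isRealOpY` BY NAME), the Hermitian symmetry `IsSymmTr 1` that follows,
and (3.34)-covariance modulo the covariance of `D̃⁽²⁾` and `Δ⁽²⁾` (def-Y's `H1Y_cov` BY NAME); it re-issues the Sect. E letters with `D2J := d2JOfY …`
at THE RECORD's `H₁` (`sectELettersYWithDt2` ∕ `sectEYWithDt2`, a `SectEY`-valued map, so every consumer certificate stated at
`… (sectEYOfRecordV6 N θ M⋆ 𝔢₀) …` applies with `𝔢₀ := sectEYWithDt2 N θ M⋆ 𝔯 𝔡₂ 𝔢₀`, zero knit) and the instance of record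
`opsYOfRecordV8E N θ M⋆ 𝔠 𝔡₂ 𝔢₀ 𝔴 𝔈 := opsYOfRecordV7E N θ M⋆ 𝔠 (sectEYWithDt2 N θ M⋆ (resYOfC2 N θ M⋆ 𝔠) 𝔡₂ 𝔢₀) 𝔴 𝔈` (`rfl` faces to v7∕v6∕v4), at which
(3.156) `Δ_k = (QG₁Q\*)⁻¹ − a − D2J` (`Node00.OpsYSectE.deltaKY`) unfolds to print's three terms with NO operator parameter left in them.  AFTER this file
the instance's free OPERATOR parameter is `𝔢₀.Gt2` (`G̃₂` of (3.183)–(3.186), [B9] Sect. E's own content) alone, next to the two [5]-type form letters `𝔠`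
(`C⁽²⁾`), `𝔡₂` (`D̃⁽²⁾`), the walk data `𝔴` and the exponents `𝔈`.  It also lands the `U = 1` unit witness `isUnit_QGQOfY_G1Y_one` for the `G₁`-version
of `QGQ\*` (FILE 22's displayed `c1_inv` hypothesis at `U₁ = 1`; asked by ref-E READ-26): def-Y's `QGQOfY_G1Y_one` ▸ n06-i's `isUnit_QGQY_one`.

MODEL ∕ DICTIONARY.  (D1) PAIRINGS are FILE 20's flat BILINEAR trace pairings `⟨Φ, Ψ⟩_τ = Σ_x τ(Φ(x)Ψ(x))` (`trPairY`; `τ = tr` at the record), on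
unit-lattice bond functions (`IBondY`, print's `⟨B, B′⟩`) and on fine-bond functions (`FBondY`, print's `⟨A, J⟩ = Σ_b η^d tr A(b)J(b)` of (3.11)) alike,
the constant sector weights dropped as in `Node00.OpsYDeltaA` (M4) ∕ FILE 20 (D1); under `Node00.OpsYSectELetters`' convention word (v) («the three
terms of `deltaKY = QG1Qinv − a − D2J` sit in ONE convention … provided the parameter `𝔢.D2J` is supplied flat-form as well») `d2JOfY` IS that flat-form
supply — a READING, no weight bookkeeping is proved here.  (D2) `J(U)` = FILE 20's `JY` (r06's (3.11)∕(3.117) current at NODE 00).  (D3) `D̃⁽²⁾` is a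
LETTER: `Dt2LettersY 𝔸 i = {form : U ↦ (B, B′) ↦ D̃⁽²⁾(U; B, B′) bilinear, symmetric}` from pairs of unit-lattice bond functions to coarse-bond functions
(`IBondY i → 𝔸`, the domain of `H₁`; at NODE 00's index level both are `IBondY`); `D̃⁽²⁾(B) = D̃⁽²⁾(U; B, B)`.  (D4) `D2J(U)B := 2·ρ_X(B′ ↦ ⟨H₁(U)D̃⁽²⁾(U; B, B′),
J(U)⟩_τ)` (`d2JOfY`), so that `⟨B′, D2J(U)B⟩_τ = 2⟨H₁(U)D̃⁽²⁾(U; B, B′), J(U)⟩_τ` — (3.156)'s `J`-term polarised; at `B′ = B` it is the printed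
`2⟨H₁D̃⁽²⁾(B), J⟩`, with SIGN as in `deltaKY` (`Δ_k = (QG₁Q\*)⁻¹ − a − D2J`).  (D5) Hermitian symmetry (`B9Thm311ReadingCoords.IsSymmTr`) from `τ`-symmetry
plus REALITY, FILE 20's `isSymmTr_of_trSymm_of_real`; reality of `D2J(U)` from reality of `D̃⁽²⁾(U)`, of `H₁(U)` (a THEOREM at the tables of record for
a real `Δ⁽²⁾(U)`: FILE 21's `H1Y_isRealOpY`) and `J(U)⋆ = J(U)` (FILE 20's `star_JY` at unitary `U`).

WHAT IS DEFINED ∕ PROVED (0 sorry; every def has a printed locus or is dictionary (D1)–(D5)).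
* §0 `trPairY_sub_right` ∕ `trPairY_sub_left` (bookkeeping for (3.156)'s differences).
* §1 `Dt2LettersY` (+ `dt2LettersY_flat`, `dt2LettersY_flat_form`) — the letter `D̃⁽²⁾`.
* §2 ★ `pairH1JY` (`B ↦ ⟨H₁B, J⟩_τ`), ★★ `d2JOfY`; ★★ `trPairY_d2JOfY` ((3.156)'s `J`-term polarised), ★★★ `trPairY_d2JOfY_self` (verbatim `2⟨H₁D̃⁽²⁾(B), J⟩`),
  `trPairY_d2JOfY_trAdj` (the `H₁†J` form, cf. (3.136)), `trPairY_d2JOfY_symm` ∕ `…_symm'` (`τ`-symmetry), ★★ `d2JOfY_unique` ((3.156) DEFINES `D2J`),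
  ★ `d2JOfY_one` (`D2J(1) = 0`, a theorem, hypothesis-free), `d2JOfY_flat`.
* §3 ★★ `sectELettersYWithDt2 𝔡 x 𝔯 𝔡₂ 𝔢 : SectELettersY 𝔸 x` (`𝔢` with `D2J := d2JOfY` at the record's `H₁ = H1Y (parSymY) (parBY) (GpY parSymY) 𝔯.Δ2`,
  `covLettersY_v4_H₁`; `D2J_one` the theorem), its `rfl` faces (`_D2J`, `_Gt2`, `_letters`), ★★★ `trPairY_deltaKY_sectELettersYWithDt2` — (3.156) VERBATIM:
  `⟨B,(QG₁Q\*)⁻¹B⟩ − ⟨B, aB⟩ − 2⟨H₁D̃⁽²⁾(B),J⟩ = ⟨B,Δ_kB⟩` for ANY Sect. D record `𝔏` and its `(QG₁Q\*)⁻¹`; `sectELettersYWithDt2_flat_D2J`.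
* §4 record (`𝔸 = M_N(ℂ)`, `𝔡 = trDualMatY N`): `Dt2Y` ∕ `dt2Y_flat`, ★★ `sectEYWithDt2 N θ M⋆ 𝔯 𝔡₂ 𝔢₀ : SectEY N θ M⋆`, ★★★ `opsYOfRecordV8E` (+ `_eq`, `_eq_V6E`,
  `_eq_V4E`, `_letters`), `sectEYWithDt2_D2J ∕ _Gt2`, `sectEYOfRecordV6_sectEYWithDt2_D2J ∕ _Gt2`, ★★★ `deltaKY_ofRecordV8` ((3.156)'s `Δ_k` at the v8
  record unfolds to `QG1QinvY − aY − d2JOfY`, `rfl`), ★★★ `sum_trace_deltaKY_ofRecordV8` ((3.156) at the record in matrix traces), `sum_trace_sectEYWithDt2_D2J`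
  ∕ `…_symm`, `sectEYWithDt2_flat_D2J`.
* §5 reality ∕ Hermitian symmetry: ★★ `d2JOfY_star` ∕ `d2JOfY_star_of_unitary` (generic), ★★ `sectEYWithDt2_D2J_isRealOpY` (at a unitary-valued `U`, modulo
  `IsRealOpY ((𝔯 x).Δ2 U)` and reality of `D̃⁽²⁾(U)`; `H₁`'s reality DISCHARGED by FILE 21), ★★ `sectEYWithDt2_D2J_isSymmTr`, ★★★ `sectEYWithDt2_D2J_isRealOpY_ofC2`
  ∕ `…_isSymmTr_ofC2` (over `𝔯 := resYOfC2 𝔠`: modulo reality of the two [5]-type letters `C⁽²⁾(U)`, `D̃⁽²⁾(U)` ALONE).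
* §6 gauge covariance (3.34): `Dt2LettersY.IsCov` ∕ `Dt2Y.IsCov` (displayed letter property, [5] (52)), `dt2LettersY_flat_isCov` ∕ `dt2Y_flat_isCov`,
  ★★ `d2JOfY_cov` (generic: from covariance of `H₁` and of the form, `J^u = R(u)J` PROVED), ★★ `sectELettersYWithDt2_D2J_cov` (`H₁`'s covariance DISCHARGED
  by def-Y's `H1Y_cov` at the tables of record, modulo `IsCovBondOpY 𝔯.Δ2`), ★★★ `sectEYWithDt2_D2J_cov_ofC2` (over `resYOfC2 𝔠`: modulo covariance of `𝔠`, `𝔡₂`).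
* §7 `U = 1` units (ref-E READ-26's WATCH on FILE 22's `c1_inv`): ★ `isUnit_QGQOfY_G1Y_one` (generic tables with their `U = 1` clauses, `Δ⁽²⁾(1) = 0`),
  ★ `isUnit_QGQOfY_G1Y_record_one` (tables of record, any residual letter), `isUnit_QGQOfY_lettersYOfRecordV4_G₁_one` (the v4 letters' `G₁`).

HONEST SCOPE.  Exact finite-dimensional trace algebra: (3.156)'s `J`-term as a DEFINITION by a quadratic form and its immediate consequences («a
parameter replaced by a function of a smaller parameter»); NO inequality of the paper (Sect. E's (3.170)–(3.187) stay N06's ∕ parameters), no positivity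
of `Δ_k` or `C\*Δ_kC` («a lower bound γ₀ > 0», p. 428 — not claimed), no claim that [5]'s `D̃⁽²⁾` has been constructed on NODE 00's carriers (it is the
letter `𝔡₂`, flat witness only; the intended instance is the unit-block restriction of `B7Eq136SecondOrder`'s second-order term, NOT constructed here),
reality ∕ covariance of `D2J(U)` proved only MODULO the displayed reality ∕ covariance of the form letters.  `G̃₂` (3.186) stays the parameter `𝔢₀.Gt2`.
NOT a node discharge, NOT summit progress; count-neutral; one finite-torus algebra at fixed lattice spacing — nothing continuum, nothing about reflection
positivity or the mass gap.  Cell `pub-ymgap` (HUMAN RULING D-0062), Track A NODE 00 definer row def-Y (successor gen 11), 2026-08-27.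
-/

noncomputable section

namespace Literature.MathematicalPhysics.QuantumFieldTheory.Balaban1983to89.Node00

open B6KLevelCensusIndexV1 (KIdx)
open B9PinMembersKLevelV1 (MemberY)
open B6GlobalChartV1 (PV domT)
open B9BackgroundsKLevelV1 (CfgV1 shiftsV1)
open B9Thm311ReadingCoords (trIP IsSymmTr)
open B9Eq3132SectDLetters (HDY GDY QGQY isUnit_QGQY_one)
open scoped Matrix
open scoped Matrix.Norms.L2Operator

/-! ## §0 Two bookkeeping identities of the trace pairing -/

section Pairing

variable {𝔸 : Type} [NormedRing 𝔸] [NormedAlgebra ℂ 𝔸] {X : Type} [Fintype X]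

/-- `⟨Φ, Ψ − Ψ′⟩_τ = ⟨Φ, Ψ⟩_τ − ⟨Φ, Ψ′⟩_τ`. [cite: Balaban1985BackgroundPropagators, (3.156) p.428, bookkeeping] -/
theorem trPairY_sub_right (τ : 𝔸 →ₗ[ℂ] ℂ) (Φ Ψ Ψ' : X → 𝔸) : trPairY τ Φ (Ψ - Ψ') = trPairY τ Φ Ψ - trPairY τ Φ Ψ' := by
  simp only [trPairY_def, Pi.sub_apply, mul_sub, map_sub, Finset.sum_sub_distrib]

/-- `⟨Φ − Φ′, Ψ⟩_τ = ⟨Φ, Ψ⟩_τ − ⟨Φ′, Ψ⟩_τ`. [cite: Balaban1985BackgroundPropagators, (3.156) p.428, bookkeeping] -/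
theorem trPairY_sub_left (τ : 𝔸 →ₗ[ℂ] ℂ) (Φ Φ' Ψ : X → 𝔸) : trPairY τ (Φ - Φ') Ψ = trPairY τ Φ Ψ - trPairY τ Φ' Ψ := by
  simp only [trPairY_def, Pi.sub_apply, sub_mul, map_sub, Finset.sum_sub_distrib]

end Pairing

/-! ## §1 The letter `D̃⁽²⁾` — [5]-type second-order averaging form «restricted to unit blocks» (p. 427), polarised -/

section Form

variable {d ℓ : ℕ} {hd : 1 ≤ d + 1} {hL : Odd (ℓ + 1) ∧ 1 < ℓ + 1} {b₀ b₁ : ℝ}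
variable (𝔸 : Type) [NormedRing 𝔸] [NormedAlgebra ℂ 𝔸] [CompleteSpace 𝔸]

/-- **THE LETTER `D̃⁽²⁾(U; B, B′)`** of (3.155)–(3.156): *«the function D̃⁽²⁾(B) is a quadratic polynomial in B with properties similar to C⁽²⁾(A), only
restricted to unit blocks»* (p. 427), POLARISED to a `U`-dependent SYMMETRIC `ℂ`-bilinear map on pairs of unit-lattice bond functions with values in the
domain of `H₁` (coarse-bond functions; both `IBondY` at the index); `D̃⁽²⁾(B) = D̃⁽²⁾(U; B, B)`.  Its lattice formula is [5]'s and is NOT an object of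
NODE 00's tree — the one residual parameter of this file (flat witness `dt2LettersY_flat`). [cite: Balaban1985BackgroundPropagators, p.427 (after (3.155)), (3.156) p.428; Balaban1985Averaging, (136) p.39; Balaban1985Variational, (56) p.286 («by polarization»)] -/
structure Dt2LettersY (i : KIdx d ℓ hd hL b₀ b₁) where
  /-- `(B, B′) ↦ D̃⁽²⁾(U; B, B′)` -/
  form : CfgY 𝔸 i → (IBondY i → 𝔸) →ₗ[ℂ] (IBondY i → 𝔸) →ₗ[ℂ] (IBondY i → 𝔸)
  /-- polarised forms are symmetric -/
  symm : ∀ (U : CfgY 𝔸 i) (B B' : IBondY i → 𝔸), form U B B' = form U B' B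

/-- the flat letter `D̃⁽²⁾ := 0` (nonvacuity; NOT [5]'s form away from the linear averaging). [cite: Balaban1985BackgroundPropagators, (3.156) p.428, bookkeeping] -/
def dt2LettersY_flat (i : KIdx d ℓ hd hL b₀ b₁) : Dt2LettersY 𝔸 i := ⟨fun _ => 0, fun _ _ _ => rfl⟩

/-- the flat letter's form is `0`. [cite: Balaban1985BackgroundPropagators, (3.156) p.428, bookkeeping] -/
@[simp] theorem dt2LettersY_flat_form (i : KIdx d ℓ hd hL b₀ b₁) (U : CfgY 𝔸 i) : (dt2LettersY_flat 𝔸 i).form U = 0 := rfl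

end Form

/-! ## §2 ★ `D2J(U)` OF (3.156) AS A FUNCTION OF `D̃⁽²⁾`: the operator of the quadratic form `B ↦ 2⟨H₁D̃⁽²⁾(B), J⟩` -/

section D2J

variable {d ℓ : ℕ} {hd : 1 ≤ d + 1} {hL : Odd (ℓ + 1) ∧ 1 < ℓ + 1} {b₀ b₁ : ℝ}
variable {𝔸 : Type} [NormedRing 𝔸] [NormedAlgebra ℂ 𝔸] [CompleteSpace 𝔸]
variable (𝔡 : TrDualY 𝔸) (i : KIdx d ℓ hd hL b₀ b₁) (parS : SiteParY 𝔸 i) (parB : BondParY 𝔸 i) (Gp : SiteOpY 𝔸 i) (Δ2 : BondOpY 𝔸 i)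

/-- ★ the functional `B ↦ ⟨H₁B, J⟩_τ` on coarse-bond functions (`H₁ = H₁(U) = G₁Q*(QG₁Q*)⁻¹` of (3.129) over the residual letter `Δ⁽²⁾`, `J = J(U)` of
(3.117)). [cite: Balaban1985BackgroundPropagators, (3.156) p.428, (3.129) p.421, (3.117) p.419] -/
def pairH1JY (U : CfgY 𝔸 i) : (IBondY i → 𝔸) →ₗ[ℂ] ℂ := (trPairBY 𝔡.τ).flip (JY i U) ∘ₗ H1Y i parS parB Gp Δ2 U

/-- the functional, evaluated. [cite: Balaban1985BackgroundPropagators, (3.156) p.428, bookkeeping] -/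
@[simp] theorem pairH1JY_apply (U : CfgY 𝔸 i) (B : IBondY i → 𝔸) :
    pairH1JY 𝔡 i parS parB Gp Δ2 U B = trPairY 𝔡.τ (H1Y i parS parB Gp Δ2 U B) (JY i U) := rfl

/-- ★★ **`D2J(U)` OF (3.156)** — THE operator of the quadratic form `B ↦ 2⟨H₁D̃⁽²⁾(B), J⟩` for the trace pairing, i.e. the `τ`-symmetric unit-lattice
bond letter with `⟨B′, D2J(U)B⟩_τ = 2⟨H₁(U)D̃⁽²⁾(U; B, B′), J(U)⟩_τ` (`trPairY_d2JOfY`; uniqueness `d2JOfY_unique`), as a FUNCTION of the letter `D̃⁽²⁾`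
(and of def-Y's `H₁`, r06's `J`): `D2J(U)B = 2·ρ_X(B′ ↦ ⟨H₁D̃⁽²⁾(B, B′), J⟩)`.  Sign and rôle as in `Node00.OpsYSectE.deltaKY`: `Δ_k = (QG₁Q*)⁻¹ − a − D2J`.
[cite: Balaban1985BackgroundPropagators, (3.156) p.428, p.427 (after (3.155))] -/
def d2JOfY (D : CfgY 𝔸 i → (IBondY i → 𝔸) →ₗ[ℂ] (IBondY i → 𝔸) →ₗ[ℂ] (IBondY i → 𝔸)) : IBondOpY 𝔸 i := fun U =>
  (2 : ℂ) • (rieszY 𝔡 ∘ₗ LinearMap.llcomp ℂ (IBondY i → 𝔸) (IBondY i → 𝔸) ℂ (pairH1JY 𝔡 i parS parB Gp Δ2 U) ∘ₗ D U)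

variable (D : CfgY 𝔸 i → (IBondY i → 𝔸) →ₗ[ℂ] (IBondY i → 𝔸) →ₗ[ℂ] (IBondY i → 𝔸))

/-- ★★ **(3.156)'s `J`-TERM, POLARISED**: `⟨B′, D2J(U)B⟩_τ = 2⟨H₁(U)D̃⁽²⁾(U; B, B′), J(U)⟩_τ`. [cite: Balaban1985BackgroundPropagators, (3.156) p.428] -/
theorem trPairY_d2JOfY (U : CfgY 𝔸 i) (B B' : IBondY i → 𝔸) :
    trPairY 𝔡.τ B' (d2JOfY 𝔡 i parS parB Gp Δ2 D U B) = 2 * trPairY 𝔡.τ (H1Y i parS parB Gp Δ2 U (D U B B')) (JY i U) := by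
  rw [d2JOfY, LinearMap.smul_apply, trPairY_smul_right, LinearMap.comp_apply, LinearMap.comp_apply, trPairY_rieszY]
  rfl

/-- ★★★ **(3.156)'s `J`-TERM VERBATIM**: `⟨B, D2J B⟩ = 2⟨H₁D̃⁽²⁾(B), J⟩`, `D̃⁽²⁾(B) = D̃⁽²⁾(U; B, B)`. [cite: Balaban1985BackgroundPropagators, (3.156) p.428] -/
theorem trPairY_d2JOfY_self (U : CfgY 𝔸 i) (B : IBondY i → 𝔸) :
    trPairY 𝔡.τ B (d2JOfY 𝔡 i parS parB Gp Δ2 D U B) = 2 * trPairY 𝔡.τ (H1Y i parS parB Gp Δ2 U (D U B B)) (JY i U) :=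
  trPairY_d2JOfY 𝔡 i parS parB Gp Δ2 D U B B

/-- ★ **WITH `H₁†`**: `⟨B′, D2J B⟩_τ = 2⟨D̃⁽²⁾(B, B′), H₁†J⟩_τ` — `H₁` moved onto the current by the `τ`-transpose (`trAdjY`), the shape of (3.136)'s «(H*J)(b)»
one section earlier (p. 427: «We have the same situation for the operators H₁»). [cite: Balaban1985BackgroundPropagators, (3.156) p.428, (3.136) p.422, p.427] -/
theorem trPairY_d2JOfY_trAdj (U : CfgY 𝔸 i) (B B' : IBondY i → 𝔸) :
    trPairY 𝔡.τ B' (d2JOfY 𝔡 i parS parB Gp Δ2 D U B) = 2 * trPairY 𝔡.τ (D U B B') (trAdjY 𝔡 (H1Y i parS parB Gp Δ2 U) (JY i U)) := by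
  rw [trPairY_d2JOfY, trPairY_trAdjY]

/-- ★ **`D2J(U)` IS `τ`-SYMMETRIC** for a symmetric `D̃⁽²⁾(U; ·, ·)`: `⟨B′, D2J B⟩_τ = ⟨B, D2J B′⟩_τ`. [cite: Balaban1985BackgroundPropagators, (3.156) p.428 (a quadratic form's operator)] -/
theorem trPairY_d2JOfY_symm (hD : ∀ (U : CfgY 𝔸 i) (B B' : IBondY i → 𝔸), D U B B' = D U B' B) (U : CfgY 𝔸 i) (B B' : IBondY i → 𝔸) :
    trPairY 𝔡.τ B' (d2JOfY 𝔡 i parS parB Gp Δ2 D U B) = trPairY 𝔡.τ B (d2JOfY 𝔡 i parS parB Gp Δ2 D U B') := by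
  rw [trPairY_d2JOfY, trPairY_d2JOfY, hD]

/-- ★ `τ`-symmetry in the shape `⟨D2J B, B″⟩_τ = ⟨B, D2J B″⟩_τ` (the shape of def-Y's `IsSymmTr` consumers). [cite: Balaban1985BackgroundPropagators, (3.156) p.428, bookkeeping] -/
theorem trPairY_d2JOfY_symm' (hD : ∀ (U : CfgY 𝔸 i) (B B' : IBondY i → 𝔸), D U B B' = D U B' B) (U : CfgY 𝔸 i) (B B'' : IBondY i → 𝔸) :
    trPairY 𝔡.τ (d2JOfY 𝔡 i parS parB Gp Δ2 D U B) B'' = trPairY 𝔡.τ B (d2JOfY 𝔡 i parS parB Gp Δ2 D U B'') := by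
  rw [trPairY_comm 𝔡.τ 𝔡.τ_comm, trPairY_d2JOfY_symm 𝔡 i parS parB Gp Δ2 D hD]

/-- ★★ **UNIQUENESS — (3.156) DEFINES `D2J`**: a `τ`-symmetric unit-lattice bond operator with the quadratic form `2⟨H₁D̃⁽²⁾(B), J⟩` IS `D2J(U)`
(polarisation + separation of the trace pairing). [cite: Balaban1985BackgroundPropagators, (3.156) p.428 («can be written also as»)] -/
theorem d2JOfY_unique (hD : ∀ (U : CfgY 𝔸 i) (B B' : IBondY i → 𝔸), D U B B' = D U B' B) (U : CfgY 𝔸 i)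
    (T : (IBondY i → 𝔸) →ₗ[ℂ] (IBondY i → 𝔸)) (hT : ∀ B B'' : IBondY i → 𝔸, trPairY 𝔡.τ (T B) B'' = trPairY 𝔡.τ B (T B''))
    (h156 : ∀ B : IBondY i → 𝔸, trPairY 𝔡.τ B (T B) = 2 * trPairY 𝔡.τ (H1Y i parS parB Gp Δ2 U (D U B B)) (JY i U)) :
    T = d2JOfY 𝔡 i parS parB Gp Δ2 D U := by
  refine LinearMap.ext fun B => trPairY_left_ext 𝔡 fun B' => ?_
  have h2 : (2 : ℂ) ≠ 0 := two_ne_zero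
  refine mul_left_cancel₀ h2 ?_
  rw [trPairY_polarize 𝔡 T hT, trPairY_polarize 𝔡 _ (trPairY_d2JOfY_symm' 𝔡 i parS parB Gp Δ2 D hD U), h156, h156, h156,
    trPairY_d2JOfY_self, trPairY_d2JOfY_self, trPairY_d2JOfY_self]

/-- ★ **`D2J(1) = 0`** — the lineage's `U = 1` clause `SectELettersY.D2J_one`, now a THEOREM of the construction (`JY_one'`: `∂U = 1 ⇒ J = 0`; NO
hypothesis on the tables or on `Δ⁽²⁾`). [cite: Balaban1985BackgroundPropagators, (3.156) p.428, (3.117) p.419, (3.11) p.392, bookkeeping] -/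
theorem d2JOfY_one : d2JOfY 𝔡 i parS parB Gp Δ2 D (fun _ _ => 1) = 0 := by
  refine LinearMap.ext fun B => trPairY_left_ext 𝔡 fun B' => ?_
  rw [trPairY_d2JOfY, JY_one', trPairY_zero_right, mul_zero, LinearMap.zero_apply, trPairY_zero_right]

/-- `D2J ≡ 0` for the flat letter `D̃⁽²⁾ = 0`. [cite: Balaban1985BackgroundPropagators, (3.156) p.428, bookkeeping] -/
theorem d2JOfY_flat (U : CfgY 𝔸 i) : d2JOfY 𝔡 i parS parB Gp Δ2 (fun _ => 0) U = 0 := by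
  refine LinearMap.ext fun B => trPairY_left_ext 𝔡 fun B' => ?_
  rw [trPairY_d2JOfY, LinearMap.zero_apply, LinearMap.zero_apply, map_zero, trPairY_zero_left, mul_zero, LinearMap.zero_apply,
    trPairY_zero_right]

end D2J

/-! ## §3 ★★ The Sect. E letters with `D2J := d2JOfY` at THE RECORD's `H₁`: `sectELettersYWithDt2`, and (3.156) VERBATIM -/

section Letters

variable {d ℓ : ℕ} {hd : 1 ≤ d + 1} {hL : Odd (ℓ + 1) ∧ 1 < ℓ + 1} {b₀ b₁ : ℝ} {Mstar : ℕ}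
variable {𝔸 : Type} [NormedRing 𝔸] [NormedAlgebra ℂ 𝔸] [CompleteSpace 𝔸] (𝔡 : TrDualY 𝔸)

/-- ★★ **THE SECT. E LETTERS WITH (3.156)'s `J`-TERM AS A FUNCTION OF `D̃⁽²⁾`** at a member: `𝔢` with `D2J := d2JOfY` built from def-Y's `H₁` OF RECORD
(`H1Y` over `parSymY`, `parBY`, `GpY parSymY` and the residual letter `𝔯.Δ2` — the v4 record's `H₁`, `covLettersY_v4_H₁`) and r06's `J`, its `U = 1`
clause PROVED; every other field of `𝔢` (`Λ̃ ∕ C ∕ C* ∕ μ ∕ μ* ∕ D̄ ∕ D̄* ∕ G̃₂`) kept. [cite: Balaban1985BackgroundPropagators, (3.156) p.428, (3.129) p.421, (3.117) p.419] -/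
def sectELettersYWithDt2 (x : MemberY d ℓ hd hL b₀ b₁ Mstar) (𝔯 : ResLettersY 𝔸 x) (𝔡₂ : Dt2LettersY 𝔸 x.toKIdx) (𝔢 : SectELettersY 𝔸 x) :
    SectELettersY 𝔸 x :=
  { 𝔢 with
    D2J := d2JOfY 𝔡 x.toKIdx (parSymY x.toKIdx) (parBY x.toKIdx) (GpY x.toKIdx (parSymY x.toKIdx)) 𝔯.Δ2 𝔡₂.form
    D2J_one := d2JOfY_one 𝔡 x.toKIdx (parSymY x.toKIdx) (parBY x.toKIdx) (GpY x.toKIdx (parSymY x.toKIdx)) 𝔯.Δ2 𝔡₂.form }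

variable (x : MemberY d ℓ hd hL b₀ b₁ Mstar) (𝔯 : ResLettersY 𝔸 x) (𝔡₂ : Dt2LettersY 𝔸 x.toKIdx) (𝔢 : SectELettersY 𝔸 x)

/-- the re-issued letters' `D2J`, unfolded. [cite: Balaban1985BackgroundPropagators, (3.156) p.428, bookkeeping] -/
theorem sectELettersYWithDt2_D2J :
    (sectELettersYWithDt2 𝔡 x 𝔯 𝔡₂ 𝔢).D2J =
      d2JOfY 𝔡 x.toKIdx (parSymY x.toKIdx) (parBY x.toKIdx) (GpY x.toKIdx (parSymY x.toKIdx)) 𝔯.Δ2 𝔡₂.form := rfl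

/-- the re-issued letters keep `𝔢`'s `G̃₂` (3.186) (the remaining operator parameter). [cite: Balaban1985BackgroundPropagators, (3.186) p.432, bookkeeping] -/
theorem sectELettersYWithDt2_Gt2 : (sectELettersYWithDt2 𝔡 x 𝔯 𝔡₂ 𝔢).Gt2 = 𝔢.Gt2 := rfl

/-- the re-issued letters keep `𝔢`'s `Λ̃ ∕ C ∕ C* ∕ μ ∕ μ* ∕ D̄ ∕ D̄*`. [cite: Balaban1985BackgroundPropagators, (3.157) p.428, (3.168)–(3.169) p.430, bookkeeping] -/
theorem sectELettersYWithDt2_letters :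
    (sectELettersYWithDt2 𝔡 x 𝔯 𝔡₂ 𝔢).LamT = 𝔢.LamT ∧ (sectELettersYWithDt2 𝔡 x 𝔯 𝔡₂ 𝔢).elimC = 𝔢.elimC ∧
      (sectELettersYWithDt2 𝔡 x 𝔯 𝔡₂ 𝔢).elimCt = 𝔢.elimCt ∧ (sectELettersYWithDt2 𝔡 x 𝔯 𝔡₂ 𝔢).mu = 𝔢.mu ∧
      (sectELettersYWithDt2 𝔡 x 𝔯 𝔡₂ 𝔢).muT = 𝔢.muT ∧ (sectELettersYWithDt2 𝔡 x 𝔯 𝔡₂ 𝔢).Dbar = 𝔢.Dbar ∧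
      (sectELettersYWithDt2 𝔡 x 𝔯 𝔡₂ 𝔢).DbarT = 𝔢.DbarT :=
  ⟨rfl, rfl, rfl, rfl, rfl, rfl, rfl⟩

/-- ★★ (3.156)'s `J`-term of the re-issued letters, with THE RECORD's `H₁` (the v4 letters' `H₁`, `covLettersY_v4_H₁`): `⟨B′, D2J(U)B⟩_τ =
2⟨H₁(U)D̃⁽²⁾(U; B, B′), J(U)⟩_τ`. [cite: Balaban1985BackgroundPropagators, (3.156) p.428, (3.129) p.421] -/
theorem trPairY_sectELettersYWithDt2_D2J (U : CfgY 𝔸 x.toKIdx) (B B' : IBondY x.toKIdx → 𝔸) :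
    trPairY 𝔡.τ B' ((sectELettersYWithDt2 𝔡 x 𝔯 𝔡₂ 𝔢).D2J U B) =
      2 * trPairY 𝔡.τ ((covLettersY_v4 𝔸 x 𝔯).H₁ U (𝔡₂.form U B B')) (JY x.toKIdx U) :=
  trPairY_d2JOfY 𝔡 _ _ _ _ _ _ U B B'

/-- ★ the re-issued `D2J(U)` is `τ`-symmetric. [cite: Balaban1985BackgroundPropagators, (3.156) p.428] -/
theorem trPairY_sectELettersYWithDt2_D2J_symm (U : CfgY 𝔸 x.toKIdx) (B B'' : IBondY x.toKIdx → 𝔸) :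
    trPairY 𝔡.τ ((sectELettersYWithDt2 𝔡 x 𝔯 𝔡₂ 𝔢).D2J U B) B'' = trPairY 𝔡.τ B ((sectELettersYWithDt2 𝔡 x 𝔯 𝔡₂ 𝔢).D2J U B'') :=
  trPairY_d2JOfY_symm' 𝔡 _ _ _ _ _ _ 𝔡₂.symm U B B''

/-- ★★★ **(3.156) VERBATIM** — *«⟨B,(QG₁Q\*)⁻¹B⟩ − a⟨B,B⟩ − 2⟨H₁D̃⁽²⁾(B),J⟩ = ⟨B,Δ_kB⟩»* — for `Δ_k = deltaKY x 𝔏 (sectELettersYWithDt2 …)` over ANY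
Sect. D record `𝔏` (its `(QG₁Q*)⁻¹`), def-Y's weight operator `a = aY` (print's `a⟨B,B⟩` read `⟨B, aB⟩` as in `deltaKY`) and THIS FILE's `J`-term at the
record's `H₁`. [cite: Balaban1985BackgroundPropagators, (3.156) p.428] -/
theorem trPairY_deltaKY_sectELettersYWithDt2 (𝔏 : CovLettersY 𝔸 x) (U : CfgY 𝔸 x.toKIdx) (B : IBondY x.toKIdx → 𝔸) :
    trPairY 𝔡.τ B (𝔏.QG1Qinv U B) - trPairY 𝔡.τ B (aY x.toKIdx B)
        - 2 * trPairY 𝔡.τ ((covLettersY_v4 𝔸 x 𝔯).H₁ U (𝔡₂.form U B B)) (JY x.toKIdx U) =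
      trPairY 𝔡.τ B (deltaKY x 𝔏 (sectELettersYWithDt2 𝔡 x 𝔯 𝔡₂ 𝔢) U B) := by
  rw [deltaKY_apply, LinearMap.sub_apply, LinearMap.sub_apply, trPairY_sub_right, trPairY_sub_right, trPairY_sectELettersYWithDt2_D2J]

/-- the flat `D̃⁽²⁾` gives `D2J = 0` (the flat Sect. E letters' value). [cite: Balaban1985BackgroundPropagators, (3.156) p.428, bookkeeping] -/
theorem sectELettersYWithDt2_flat_D2J (U : CfgY 𝔸 x.toKIdx) :
    (sectELettersYWithDt2 𝔡 x 𝔯 (dt2LettersY_flat 𝔸 x.toKIdx) 𝔢).D2J U = (sectELettersY_flat 𝔸 x).D2J U :=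
  d2JOfY_flat 𝔡 _ _ _ _ _ U

end Letters

/-! ## §4 ★★★ At the record: `sectEYWithDt2`, the v8 instance `opsYOfRecordV8E`, and (3.156) in matrix traces -/

section Record

variable (N : ℕ) (θ : Stage3Params) (Mstar : ℕ)

/-- the letters `D̃⁽²⁾` of a Stage 3′(Y) family: one per member, `𝔸 = M_N(ℂ)`. [cite: Balaban1985BackgroundPropagators, p.427, (3.156) p.428; Balaban1985Averaging, (136) p.39] -/
abbrev Dt2Y : Type := ∀ x : MemberY θ.d₆ θ.ℓ₆ θ.hd' θ.hL' θ.b₀ θ.b₁ Mstar, Dt2LettersY (Matrix (Fin N) (Fin N) ℂ) x.toKIdx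

/-- the flat family (nonvacuity). [cite: Balaban1985BackgroundPropagators, (3.156) p.428, bookkeeping] -/
def dt2Y_flat : Dt2Y N θ Mstar := fun x => dt2LettersY_flat (Matrix (Fin N) (Fin N) ℂ) x.toKIdx

/-- ★★ **THE SECT. E LETTERS OF RECORD WITH `D2J := d2JOfY`**: member by member `sectELettersYWithDt2` at the trace-dual fibre of record `M_N(ℂ)`, over a
residual family `𝔯` (the record's `H₁`) and the form letters `𝔡₂` — a `SectEY`-valued map, so every face ∕ certificate stated at `sectEYOfRecordV6 N θ M⋆ 𝔢₀`
applies with `𝔢₀ := sectEYWithDt2 N θ M⋆ 𝔯 𝔡₂ 𝔢₀`. [cite: Balaban1985BackgroundPropagators, (3.156) p.428] -/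
def sectEYWithDt2 (𝔯 : ResY N θ Mstar) (𝔡₂ : Dt2Y N θ Mstar) (𝔢₀ : SectEY N θ Mstar) : SectEY N θ Mstar :=
  fun x => sectELettersYWithDt2 (trDualMatY N) x (𝔯 x) (𝔡₂ x) (𝔢₀ x)

/-- ★★★ **THE v8 INSTANCE OF RECORD** of Stage 3′(Y): the v7 instance `opsYOfRecordV7E` with the Sect. E letter `D2J` NO LONGER A PARAMETER but the
function `d2JOfY` of the letters `D̃⁽²⁾`, at the residual family `resYOfC2 𝔠` (so `H₁` is a function of `C⁽²⁾`) — every `opsYOfRecordV7E_…` ∕ `…V6E_…` ∕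
`…V4E_…` face applies verbatim (`opsYOfRecordV8E_eq`).  Remaining parametric letters: `𝔠` ([5]'s `C⁽²⁾`), `𝔡₂` ([5]-type `D̃⁽²⁾`), `𝔢₀.Gt2` (3.186), `𝔴`, `𝔈`
(`𝔢₀.D2J` is now IGNORED). [cite: Balaban1985BackgroundPropagators, Thms 3.1–3.15 pp.397–432, (3.156) p.428, (3.134) p.422] -/
def opsYOfRecordV8E (𝔠 : C2Y N θ Mstar) (𝔡₂ : Dt2Y N θ Mstar) (𝔢₀ : SectEY N θ Mstar) (𝔴 : RWEY N θ Mstar) (𝔈 : ExpsY N θ Mstar) :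
    OpsY N θ Mstar :=
  opsYOfRecordV7E N θ Mstar 𝔠 (sectEYWithDt2 N θ Mstar (resYOfC2 N θ Mstar 𝔠) 𝔡₂ 𝔢₀) 𝔴 𝔈

variable (𝔯 : ResY N θ Mstar) (𝔠 : C2Y N θ Mstar) (𝔡₂ : Dt2Y N θ Mstar) (𝔢₀ : SectEY N θ Mstar) (𝔴 : RWEY N θ Mstar) (𝔈 : ExpsY N θ Mstar)

/-- the v8 instance is the v7 instance at the re-issued Sect. E letters. [cite: Balaban1985BackgroundPropagators, (3.156) p.428, bookkeeping] -/
theorem opsYOfRecordV8E_eq :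
    opsYOfRecordV8E N θ Mstar 𝔠 𝔡₂ 𝔢₀ 𝔴 𝔈 = opsYOfRecordV7E N θ Mstar 𝔠 (sectEYWithDt2 N θ Mstar (resYOfC2 N θ Mstar 𝔠) 𝔡₂ 𝔢₀) 𝔴 𝔈 := rfl

/-- … the v6 instance at `resYOfC2 𝔠` and the re-issued letters. [cite: Balaban1985BackgroundPropagators, (3.134) p.422, (3.156) p.428, bookkeeping] -/
theorem opsYOfRecordV8E_eq_V6E :
    opsYOfRecordV8E N θ Mstar 𝔠 𝔡₂ 𝔢₀ 𝔴 𝔈 =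
      opsYOfRecordV6E N θ Mstar (resYOfC2 N θ Mstar 𝔠) (sectEYWithDt2 N θ Mstar (resYOfC2 N θ Mstar 𝔠) 𝔡₂ 𝔢₀) 𝔴 𝔈 := rfl

/-- … and the v4 instance at the v6 Sect. E letters of the re-issued letters (the shape the N06 certificates are stated at).
[cite: Balaban1985BackgroundPropagators, (3.157) p.428, bookkeeping] -/
theorem opsYOfRecordV8E_eq_V4E :
    opsYOfRecordV8E N θ Mstar 𝔠 𝔡₂ 𝔢₀ 𝔴 𝔈 =
      opsYOfRecordV4E N θ Mstar (resYOfC2 N θ Mstar 𝔠)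
        (sectEYOfRecordV6 N θ Mstar (sectEYWithDt2 N θ Mstar (resYOfC2 N θ Mstar 𝔠) 𝔡₂ 𝔢₀)) 𝔴 𝔈 := rfl

/-- the v8 instance's rows 24′∕25 letters ARE the v4 ones (so FILE 20 §7 ∕ FILE 21 apply through `opsYOfRecordV4E_letters`). [cite: Balaban1985BackgroundPropagators, Thms 3.1–3.15 pp.397–432, bookkeeping] -/
theorem opsYOfRecordV8E_letters (x : MemberY θ.d₆ θ.ℓ₆ θ.hd' θ.hL' θ.b₀ θ.b₁ Mstar) :
    (opsYOfRecordV8E N θ Mstar 𝔠 𝔡₂ 𝔢₀ 𝔴 𝔈 x).P349 =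
        (opsYOfRecordV4E N θ Mstar (resYOfC2 N θ Mstar 𝔠) (sectEYWithDt2 N θ Mstar (resYOfC2 N θ Mstar 𝔠) 𝔡₂ 𝔢₀) 𝔴 𝔈 x).P349 ∧
      (opsYOfRecordV8E N θ Mstar 𝔠 𝔡₂ 𝔢₀ 𝔴 𝔈 x).HasRWExpC =
        (opsYOfRecordV4E N θ Mstar (resYOfC2 N θ Mstar 𝔠) (sectEYWithDt2 N θ Mstar (resYOfC2 N θ Mstar 𝔠) 𝔡₂ 𝔢₀) 𝔴 𝔈 x).HasRWExpC :=
  ⟨rfl, rfl⟩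

/-- the re-issued family at a member. [cite: Balaban1985BackgroundPropagators, (3.156) p.428, bookkeeping] -/
theorem sectEYWithDt2_apply (x : MemberY θ.d₆ θ.ℓ₆ θ.hd' θ.hL' θ.b₀ θ.b₁ Mstar) :
    sectEYWithDt2 N θ Mstar 𝔯 𝔡₂ 𝔢₀ x = sectELettersYWithDt2 (trDualMatY N) x (𝔯 x) (𝔡₂ x) (𝔢₀ x) := rfl

/-- the re-issued family's `D2J` at a member, unfolded to `d2JOfY` at the record's `H₁`. [cite: Balaban1985BackgroundPropagators, (3.156) p.428, bookkeeping] -/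
theorem sectEYWithDt2_D2J (x : MemberY θ.d₆ θ.ℓ₆ θ.hd' θ.hL' θ.b₀ θ.b₁ Mstar) :
    (sectEYWithDt2 N θ Mstar 𝔯 𝔡₂ 𝔢₀ x).D2J =
      d2JOfY (trDualMatY N) x.toKIdx (parSymY x.toKIdx) (parBY x.toKIdx) (GpY x.toKIdx (parSymY x.toKIdx)) (𝔯 x).Δ2 (𝔡₂ x).form := rfl

/-- the re-issued family keeps `𝔢₀`'s `G̃₂`. [cite: Balaban1985BackgroundPropagators, (3.186) p.432, bookkeeping] -/
theorem sectEYWithDt2_Gt2 (x : MemberY θ.d₆ θ.ℓ₆ θ.hd' θ.hL' θ.b₀ θ.b₁ Mstar) : (sectEYWithDt2 N θ Mstar 𝔯 𝔡₂ 𝔢₀ x).Gt2 = (𝔢₀ x).Gt2 := rfl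

/-- the v6 Sect. E letters OF the re-issued family: `D2J` is THIS FILE's function, `G̃₂` is `𝔢₀`'s. [cite: Balaban1985BackgroundPropagators, (3.156) p.428, (3.186) p.432, bookkeeping] -/
theorem sectEYOfRecordV6_sectEYWithDt2_params (x : MemberY θ.d₆ θ.ℓ₆ θ.hd' θ.hL' θ.b₀ θ.b₁ Mstar) :
    (sectEYOfRecordV6 N θ Mstar (sectEYWithDt2 N θ Mstar 𝔯 𝔡₂ 𝔢₀) x).D2J =
        d2JOfY (trDualMatY N) x.toKIdx (parSymY x.toKIdx) (parBY x.toKIdx) (GpY x.toKIdx (parSymY x.toKIdx)) (𝔯 x).Δ2 (𝔡₂ x).form ∧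
      (sectEYOfRecordV6 N θ Mstar (sectEYWithDt2 N θ Mstar 𝔯 𝔡₂ 𝔢₀) x).Gt2 = (𝔢₀ x).Gt2 :=
  ⟨rfl, rfl⟩

/-- ★★★ **(3.156)'s `Δ_k` AT THE v8 RECORD HAS NO OPERATOR PARAMETER LEFT**: over the v4 letters at `𝔯` and the v6 Sect. E letters of the re-issued family,
`Δ_k(U) = (QG₁Q*)⁻¹(U) − a − D2J(U)` unfolds to def-Y's `QG1QinvY` (3.132), `aY` (3.26) and THIS FILE's `d2JOfY` (`rfl`). [cite: Balaban1985BackgroundPropagators, (3.156) p.428, (3.132) p.422] -/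
theorem deltaKY_ofRecordV8 (x : MemberY θ.d₆ θ.ℓ₆ θ.hd' θ.hL' θ.b₀ θ.b₁ Mstar) (U : CfgY (Matrix (Fin N) (Fin N) ℂ) x.toKIdx) :
    deltaKY x (lettersYOfRecordV4 N θ Mstar 𝔯 x) (sectEYOfRecordV6 N θ Mstar (sectEYWithDt2 N θ Mstar 𝔯 𝔡₂ 𝔢₀) x) U =
      QG1QinvY x.toKIdx (parSymY x.toKIdx) (parBY x.toKIdx) (GpY x.toKIdx (parSymY x.toKIdx)) (𝔯 x).Δ2 U - aY x.toKIdx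
        - d2JOfY (trDualMatY N) x.toKIdx (parSymY x.toKIdx) (parBY x.toKIdx) (GpY x.toKIdx (parSymY x.toKIdx)) (𝔯 x).Δ2 (𝔡₂ x).form U := rfl

/-- ★★★ **(3.156) AT THE RECORD, IN MATRIX TRACES**: `Σ_b tr(B(b)((QG₁Q*)⁻¹(U)B)(b)) − Σ_b tr(B(b)(aB)(b)) − 2·Σ_b tr((H₁(U)D̃⁽²⁾(U; B, B))(b)·J(U)(b))
= Σ_b tr(B(b)(Δ_k(U)B)(b))` — the printed equation over the v4 letters of record and the re-issued Sect. E letters. [cite: Balaban1985BackgroundPropagators, (3.156) p.428] -/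
theorem sum_trace_deltaKY_ofRecordV8 (x : MemberY θ.d₆ θ.ℓ₆ θ.hd' θ.hL' θ.b₀ θ.b₁ Mstar) (U : CfgY (Matrix (Fin N) (Fin N) ℂ) x.toKIdx)
    (B : IBondY x.toKIdx → Matrix (Fin N) (Fin N) ℂ) :
    ∑ b, Matrix.trace (B b * QG1QinvY x.toKIdx (parSymY x.toKIdx) (parBY x.toKIdx) (GpY x.toKIdx (parSymY x.toKIdx)) (𝔯 x).Δ2 U B b)
        - ∑ b, Matrix.trace (B b * aY x.toKIdx B b)
        - 2 * ∑ b, Matrix.trace (H1Y x.toKIdx (parSymY x.toKIdx) (parBY x.toKIdx) (GpY x.toKIdx (parSymY x.toKIdx)) (𝔯 x).Δ2 U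
            ((𝔡₂ x).form U B B) b * JY x.toKIdx U b) =
      ∑ b, Matrix.trace (B b * deltaKY x (lettersYOfRecordV4 N θ Mstar 𝔯 x)
        (sectEYOfRecordV6 N θ Mstar (sectEYWithDt2 N θ Mstar 𝔯 𝔡₂ 𝔢₀) x) U B b) :=
  trPairY_deltaKY_sectELettersYWithDt2 (trDualMatY N) x (𝔯 x) (𝔡₂ x) (𝔢₀ x) (lettersYOfRecordV4 N θ Mstar 𝔯 x) U B

/-- ★ (3.156)'s `J`-term at the record in matrix traces: `Σ_b tr(B′(b)(D2J(U)B)(b)) = 2·Σ_b tr((H₁(U)D̃⁽²⁾(U; B, B′))(b)·J(U)(b))`.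
[cite: Balaban1985BackgroundPropagators, (3.156) p.428] -/
theorem sum_trace_sectEYWithDt2_D2J (x : MemberY θ.d₆ θ.ℓ₆ θ.hd' θ.hL' θ.b₀ θ.b₁ Mstar) (U : CfgY (Matrix (Fin N) (Fin N) ℂ) x.toKIdx)
    (B B' : IBondY x.toKIdx → Matrix (Fin N) (Fin N) ℂ) :
    ∑ b, Matrix.trace (B' b * (sectEYWithDt2 N θ Mstar 𝔯 𝔡₂ 𝔢₀ x).D2J U B b) =
      2 * ∑ b, Matrix.trace (H1Y x.toKIdx (parSymY x.toKIdx) (parBY x.toKIdx) (GpY x.toKIdx (parSymY x.toKIdx)) (𝔯 x).Δ2 U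
        ((𝔡₂ x).form U B B') b * JY x.toKIdx U b) :=
  trPairY_sectELettersYWithDt2_D2J (trDualMatY N) x (𝔯 x) (𝔡₂ x) (𝔢₀ x) U B B'

/-- ★ the record's `D2J(U)` is trace-symmetric: `Σ_b tr((D2J B)(b)B″(b)) = Σ_b tr(B(b)(D2J B″)(b))`. [cite: Balaban1985BackgroundPropagators, (3.156) p.428] -/
theorem sum_trace_sectEYWithDt2_D2J_symm (x : MemberY θ.d₆ θ.ℓ₆ θ.hd' θ.hL' θ.b₀ θ.b₁ Mstar) (U : CfgY (Matrix (Fin N) (Fin N) ℂ) x.toKIdx)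
    (B B'' : IBondY x.toKIdx → Matrix (Fin N) (Fin N) ℂ) :
    ∑ b, Matrix.trace ((sectEYWithDt2 N θ Mstar 𝔯 𝔡₂ 𝔢₀ x).D2J U B b * B'' b) =
      ∑ b, Matrix.trace (B b * (sectEYWithDt2 N θ Mstar 𝔯 𝔡₂ 𝔢₀ x).D2J U B'' b) :=
  trPairY_sectELettersYWithDt2_D2J_symm (trDualMatY N) x (𝔯 x) (𝔡₂ x) (𝔢₀ x) U B B''

/-- the flat `D̃⁽²⁾` family reproduces the flat Sect. E letters' `D2J = 0` member by member. [cite: Balaban1985BackgroundPropagators, (3.156) p.428, bookkeeping] -/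
theorem sectEYWithDt2_flat_D2J (x : MemberY θ.d₆ θ.ℓ₆ θ.hd' θ.hL' θ.b₀ θ.b₁ Mstar) (U : CfgY (Matrix (Fin N) (Fin N) ℂ) x.toKIdx) :
    (sectEYWithDt2 N θ Mstar 𝔯 (dt2Y_flat N θ Mstar) 𝔢₀ x).D2J U = (sectEY_flat N θ Mstar x).D2J U :=
  sectELettersYWithDt2_flat_D2J (trDualMatY N) x (𝔯 x) (𝔢₀ x) U

end Record

/-! ## §5 Reality: `D2J(U)` is REAL for real letters `D̃⁽²⁾(U)`, `Δ⁽²⁾(U)` at a unitary background — and symmetric in def-Y's Hermitian currency -/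

section StarY

variable {d ℓ : ℕ} {hd : 1 ≤ d + 1} {hL : Odd (ℓ + 1) ∧ 1 < ℓ + 1} {b₀ b₁ : ℝ}
variable {𝔸 : Type} [NormedRing 𝔸] [NormedAlgebra ℂ 𝔸] [CompleteSpace 𝔸] [StarRing 𝔸] [StarModule ℂ 𝔸]
variable (i : KIdx d ℓ hd hL b₀ b₁) (𝔡 : TrDualY 𝔸) (parS : SiteParY 𝔸 i) (parB : BondParY 𝔸 i) (Gp : SiteOpY 𝔸 i) (Δ2 : BondOpY 𝔸 i)
variable (D : CfgY 𝔸 i → (IBondY i → 𝔸) →ₗ[ℂ] (IBondY i → 𝔸) →ₗ[ℂ] (IBondY i → 𝔸))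

omit [StarModule ℂ 𝔸] in
/-- ★★ **`D2J(U)` IS REAL FOR REAL LETTERS**: if `D̃⁽²⁾(U; B⋆, B′⋆) = D̃⁽²⁾(U; B, B′)⋆`, `H₁(U)X⋆ = (H₁(U)X)⋆` and `J(U)⋆ = J(U)` (a theorem at unitary `U`,
FILE 20's `star_JY`), then `D2J(U)B⋆ = (D2J(U)B)⋆` (for a `⋆`-compatible tracial `τ`). [cite: Balaban1985BackgroundPropagators, (3.156) p.428, (3.11) p.392, p.391 (hermitian-valued functions)] -/
theorem d2JOfY_star (hτ : ∀ a : 𝔸, 𝔡.τ (star a) = star (𝔡.τ a)) (U : CfgY 𝔸 i)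
    (hD : ∀ B B' : IBondY i → 𝔸, D U (star B) (star B') = star (D U B B'))
    (hH : ∀ X : IBondY i → 𝔸, H1Y i parS parB Gp Δ2 U (star X) = star (H1Y i parS parB Gp Δ2 U X)) (hJ : star (JY i U) = JY i U)
    (B : IBondY i → 𝔸) :
    d2JOfY 𝔡 i parS parB Gp Δ2 D U (star B) = star (d2JOfY 𝔡 i parS parB Gp Δ2 D U B) := by
  refine trPairY_left_ext 𝔡 fun Φ => ?_
  have hD' : D U (star B) Φ = star (D U B (star Φ)) := by simpa only [star_star] using hD B (star Φ)
  have h2 : star (2 : ℂ) = 2 := star_ofNat 2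
  have hL : trPairY 𝔡.τ Φ (d2JOfY 𝔡 i parS parB Gp Δ2 D U (star B)) =
      2 * star (trPairY 𝔡.τ (H1Y i parS parB Gp Δ2 U (D U B (star Φ))) (JY i U)) := by
    rw [trPairY_d2JOfY, hD', hH]
    congr 1
    calc trPairY 𝔡.τ (star (H1Y i parS parB Gp Δ2 U (D U B (star Φ)))) (JY i U)
          = trPairY 𝔡.τ (star (H1Y i parS parB Gp Δ2 U (D U B (star Φ)))) (star (JY i U)) := by rw [hJ]
      _ = star (trPairY 𝔡.τ (JY i U) (H1Y i parS parB Gp Δ2 U (D U B (star Φ)))) := trPairY_star 𝔡.τ hτ _ _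
      _ = star (trPairY 𝔡.τ (H1Y i parS parB Gp Δ2 U (D U B (star Φ))) (JY i U)) := by rw [trPairY_comm 𝔡.τ 𝔡.τ_comm]
  have hR : trPairY 𝔡.τ Φ (star (d2JOfY 𝔡 i parS parB Gp Δ2 D U B)) =
      2 * star (trPairY 𝔡.τ (H1Y i parS parB Gp Δ2 U (D U B (star Φ))) (JY i U)) := by
    calc trPairY 𝔡.τ Φ (star (d2JOfY 𝔡 i parS parB Gp Δ2 D U B))
          = trPairY 𝔡.τ (star (star Φ)) (star (d2JOfY 𝔡 i parS parB Gp Δ2 D U B)) := by rw [star_star]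
      _ = star (trPairY 𝔡.τ (d2JOfY 𝔡 i parS parB Gp Δ2 D U B) (star Φ)) := trPairY_star 𝔡.τ hτ _ _
      _ = star (trPairY 𝔡.τ (star Φ) (d2JOfY 𝔡 i parS parB Gp Δ2 D U B)) := by rw [trPairY_comm 𝔡.τ 𝔡.τ_comm]
      _ = 2 * star (trPairY 𝔡.τ (H1Y i parS parB Gp Δ2 U (D U B (star Φ))) (JY i U)) := by rw [trPairY_d2JOfY, star_mul, h2, mul_comm]
  rw [hL, hR]

/-- ★★ reality of `D2J(U)` at a UNITARY background from reality of `D̃⁽²⁾(U)` and `H₁(U)` (`J(U)⋆ = J(U)` discharged by `star_JY`).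
[cite: Balaban1985BackgroundPropagators, (3.156) p.428, (3.11) p.392, p.396 («values in G»)] -/
theorem d2JOfY_star_of_unitary (hτ : ∀ a : 𝔸, 𝔡.τ (star a) = star (𝔡.τ a)) {U : CfgY 𝔸 i}
    (hU : ∀ μ y, star ((U μ y : 𝔸ˣ) : 𝔸) = (((U μ y)⁻¹ : 𝔸ˣ) : 𝔸))
    (hD : ∀ B B' : IBondY i → 𝔸, D U (star B) (star B') = star (D U B B'))
    (hH : ∀ X : IBondY i → 𝔸, H1Y i parS parB Gp Δ2 U (star X) = star (H1Y i parS parB Gp Δ2 U X)) (B : IBondY i → 𝔸) :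
    d2JOfY 𝔡 i parS parB Gp Δ2 D U (star B) = star (d2JOfY 𝔡 i parS parB Gp Δ2 D U B) :=
  d2JOfY_star i 𝔡 parS parB Gp Δ2 D hτ U hD hH (star_JY i hU) B

end StarY

section StarRecord

variable {N : ℕ} (θ : Stage3Params) (Mstar : ℕ) (𝔯 : ResY N θ Mstar) (𝔠 : C2Y N θ Mstar) (𝔡₂ : Dt2Y N θ Mstar) (𝔢₀ : SectEY N θ Mstar)

/-- ★★ **THE RECORD's `D2J(U)` IS REAL** at a unitary-valued `U`, for a real `D̃⁽²⁾(U)` and a real residual letter `Δ⁽²⁾(U)` — `H₁(U)`'s reality is FILE 21's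
THEOREM `H1Y_isRealOpY` at the tables of record. [cite: Balaban1985BackgroundPropagators, (3.156) p.428, (3.129) p.421, p.396 («values in G»)] -/
theorem sectEYWithDt2_D2J_isRealOpY (x : MemberY θ.d₆ θ.ℓ₆ θ.hd' θ.hL' θ.b₀ θ.b₁ Mstar) {U : CfgY (Matrix (Fin N) (Fin N) ℂ) x.toKIdx}
    (hU : ∀ μ y, U μ y ∈ B7Prop2Explicit.unitaryUnits (Matrix (Fin N) (Fin N) ℂ))
    (hD : ∀ B B' : IBondY x.toKIdx → Matrix (Fin N) (Fin N) ℂ, (𝔡₂ x).form U (star B) (star B') = star ((𝔡₂ x).form U B B'))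
    (hΔ2 : IsRealOpY ((𝔯 x).Δ2 U)) :
    IsRealOpY ((sectEYWithDt2 N θ Mstar 𝔯 𝔡₂ 𝔢₀ x).D2J U) := by
  have hUu := mem_unitary_of_mem_unitaryUnits x.toKIdx hU
  have hS := parSymY_mem_unitary x.toKIdx hU
  have hB := parBY_mem_unitary x.toKIdx hU
  have hGp := GpY_parSymY_isRealOpY x.toKIdx hU
  have hH1 := H1Y_isRealOpY x.toKIdx U hUu _ _ _ hS hB hGp _ hΔ2
  exact fun B => d2JOfY_star_of_unitary x.toKIdx (trDualMatY N) _ _ _ _ _ trDualMatY_τ_star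
    (star_eq_inv_of_mem_unitaryUnits x.toKIdx hU) hD hH1 B

/-- ★★ **THE RECORD's `D2J(U)` IS SYMMETRIC IN def-Y's HERMITIAN CURRENCY** (`IsSymmTr 1`) at a unitary-valued `U`, for real `D̃⁽²⁾(U)`, `Δ⁽²⁾(U)` — by
FILE 20's `isSymmTr_of_trSymm_of_real`. [cite: Balaban1985BackgroundPropagators, (3.156) p.428, Thm 3.11 p.416 («symmetric»)] -/
theorem sectEYWithDt2_D2J_isSymmTr (x : MemberY θ.d₆ θ.ℓ₆ θ.hd' θ.hL' θ.b₀ θ.b₁ Mstar) {U : CfgY (Matrix (Fin N) (Fin N) ℂ) x.toKIdx}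
    (hU : ∀ μ y, U μ y ∈ B7Prop2Explicit.unitaryUnits (Matrix (Fin N) (Fin N) ℂ))
    (hD : ∀ B B' : IBondY x.toKIdx → Matrix (Fin N) (Fin N) ℂ, (𝔡₂ x).form U (star B) (star B') = star ((𝔡₂ x).form U B B'))
    (hΔ2 : IsRealOpY ((𝔯 x).Δ2 U)) :
    IsSymmTr (fun _ => (1 : ℝ)) ((sectEYWithDt2 N θ Mstar 𝔯 𝔡₂ 𝔢₀ x).D2J U) :=
  isSymmTr_of_trSymm_of_real _ (sum_trace_sectEYWithDt2_D2J_symm N θ Mstar 𝔯 𝔡₂ 𝔢₀ x U)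
    (sectEYWithDt2_D2J_isRealOpY θ Mstar 𝔯 𝔡₂ 𝔢₀ x hU hD hΔ2)

/-- ★★★ **OVER `𝔯 := resYOfC2 𝔠` (the v8 record): `D2J(U)` IS REAL at a unitary-valued `U` MODULO THE REALITY OF THE TWO [5]-TYPE LETTERS `C⁽²⁾(U)`,
`D̃⁽²⁾(U)` ALONE** (`Δ⁽²⁾(U)`'s reality is FILE 21's `resYOfC2_Δ2_isRealOpY`). [cite: Balaban1985BackgroundPropagators, (3.156) p.428, (3.134) p.422] -/
theorem sectEYWithDt2_D2J_isRealOpY_ofC2 (x : MemberY θ.d₆ θ.ℓ₆ θ.hd' θ.hL' θ.b₀ θ.b₁ Mstar) {U : CfgY (Matrix (Fin N) (Fin N) ℂ) x.toKIdx}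
    (hU : ∀ μ y, U μ y ∈ B7Prop2Explicit.unitaryUnits (Matrix (Fin N) (Fin N) ℂ))
    (hC : ∀ A A' : FBondY x.toKIdx → Matrix (Fin N) (Fin N) ℂ, (𝔠 x).form U (star A) (star A') = star ((𝔠 x).form U A A'))
    (hD : ∀ B B' : IBondY x.toKIdx → Matrix (Fin N) (Fin N) ℂ, (𝔡₂ x).form U (star B) (star B') = star ((𝔡₂ x).form U B B')) :
    IsRealOpY ((sectEYWithDt2 N θ Mstar (resYOfC2 N θ Mstar 𝔠) 𝔡₂ 𝔢₀ x).D2J U) :=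
  sectEYWithDt2_D2J_isRealOpY θ Mstar _ 𝔡₂ 𝔢₀ x hU hD (resYOfC2_Δ2_isRealOpY θ Mstar 𝔠 x hU hC)

/-- ★★★ over `𝔯 := resYOfC2 𝔠`: `D2J(U)` is `IsSymmTr 1` at a unitary-valued `U` modulo the reality of `C⁽²⁾(U)`, `D̃⁽²⁾(U)` alone.
[cite: Balaban1985BackgroundPropagators, (3.156) p.428, Thm 3.11 p.416] -/
theorem sectEYWithDt2_D2J_isSymmTr_ofC2 (x : MemberY θ.d₆ θ.ℓ₆ θ.hd' θ.hL' θ.b₀ θ.b₁ Mstar) {U : CfgY (Matrix (Fin N) (Fin N) ℂ) x.toKIdx}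
    (hU : ∀ μ y, U μ y ∈ B7Prop2Explicit.unitaryUnits (Matrix (Fin N) (Fin N) ℂ))
    (hC : ∀ A A' : FBondY x.toKIdx → Matrix (Fin N) (Fin N) ℂ, (𝔠 x).form U (star A) (star A') = star ((𝔠 x).form U A A'))
    (hD : ∀ B B' : IBondY x.toKIdx → Matrix (Fin N) (Fin N) ℂ, (𝔡₂ x).form U (star B) (star B') = star ((𝔡₂ x).form U B B')) :
    IsSymmTr (fun _ => (1 : ℝ)) ((sectEYWithDt2 N θ Mstar (resYOfC2 N θ Mstar 𝔠) 𝔡₂ 𝔢₀ x).D2J U) :=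
  sectEYWithDt2_D2J_isSymmTr θ Mstar _ 𝔡₂ 𝔢₀ x hU hD (resYOfC2_Δ2_isRealOpY θ Mstar 𝔠 x hU hC)

end StarRecord

/-! ## §6 Gauge covariance of `D2J(U)` (3.34): `D2J(U^u)R(u) = R(u)D2J(U)` — from `J^u = R(u)J` (3.30, proved) and the covariance of `H₁`, `D̃⁽²⁾` -/

section Cov

variable {𝔸 : Type} [NormedRing 𝔸] [NormedAlgebra ℂ 𝔸] [CompleteSpace 𝔸] (𝔡 : TrDualY 𝔸)
variable {d ℓ : ℕ} {hd : 1 ≤ d + 1} {hL : Odd (ℓ + 1) ∧ 1 < ℓ + 1} {b₀ b₁ : ℝ} {Mstar : ℕ}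
variable (i : KIdx d ℓ hd hL b₀ b₁) (parS : SiteParY 𝔸 i) (parB : BondParY 𝔸 i) (Gp : SiteOpY 𝔸 i) (Δ2 : BondOpY 𝔸 i)
variable (D : CfgY 𝔸 i → (IBondY i → 𝔸) →ₗ[ℂ] (IBondY i → 𝔸) →ₗ[ℂ] (IBondY i → 𝔸))

/-- ★★ **`D2J(U^u)R(u) = R(u)D2J(U)`** — (3.34)'s covariance for (3.156)'s `J`-term, at ANY tables, from the covariance of `H₁` (displayed:
`H₁(U^u)R(u) = R(u)H₁(U)` from coarse bonds to bonds; def-Y's `H1Y_cov` at covariant tables) and of the form `D̃⁽²⁾` (displayed: `D̃⁽²⁾(U^u; R(u)B, R(u)B′) =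
R(u)D̃⁽²⁾(U; B, B′)`); `J^u = R(u)J` is PROVED (FILE 20's `JY_gaugeY`) and the pairing is `R(u)`-invariant. [cite: Balaban1985BackgroundPropagators, (3.156) p.428, (3.34) p.396, (3.30) p.395] -/
theorem d2JOfY_cov (g : GaugeY 𝔸 i) (U : CfgY 𝔸 i)
    (hH : Intw (conjY (gIBondY i g)) (conjY (gBondY i g)) (H1Y i parS parB Gp Δ2 U) (H1Y i parS parB Gp Δ2 (gaugeY i g U)))
    (hD : ∀ B B' : IBondY i → 𝔸, D (gaugeY i g U) (conjY (gIBondY i g) B) (conjY (gIBondY i g) B') = conjY (gIBondY i g) (D U B B')) :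
    Intw (conjY (gIBondY i g)) (conjY (gIBondY i g)) (d2JOfY 𝔡 i parS parB Gp Δ2 D U) (d2JOfY 𝔡 i parS parB Gp Δ2 D (gaugeY i g U)) := by
  refine LinearMap.ext fun B => ?_
  rw [LinearMap.comp_apply, LinearMap.comp_apply]
  refine trPairY_left_ext 𝔡 fun B' => ?_
  conv_lhs => rw [← conjY_conjY_inv (gIBondY i g) B']
  conv_rhs => rw [← conjY_conjY_inv (gIBondY i g) B']
  rw [trPairY_d2JOfY, hD, hH.apply, JY_gaugeY, trPairY_conjY, trPairY_conjY, trPairY_d2JOfY]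

/-- **COVARIANCE OF THE FORM LETTER** `D̃⁽²⁾` at an index (displayed letter property; print: the averaging operations and their Taylor terms are
covariant, [5] (52) p.26). [cite: Balaban1985BackgroundPropagators, (3.33)–(3.34) p.396; Balaban1985Averaging, (52) p.26] -/
def Dt2LettersY.IsCov {x : KIdx d ℓ hd hL b₀ b₁} (𝔡₂ : Dt2LettersY 𝔸 x) : Prop :=
  ∀ (g : GaugeY 𝔸 x) (U : CfgY 𝔸 x) (B B' : IBondY x → 𝔸),
    𝔡₂.form (gaugeY x g U) (conjY (gIBondY x g) B) (conjY (gIBondY x g) B') = conjY (gIBondY x g) (𝔡₂.form U B B')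

/-- the flat form letter is covariant. [cite: Balaban1985BackgroundPropagators, (3.34) p.396, bookkeeping] -/
theorem dt2LettersY_flat_isCov (x : KIdx d ℓ hd hL b₀ b₁) : (dt2LettersY_flat 𝔸 x).IsCov := fun g U B B' => by
  simp only [dt2LettersY_flat_form, LinearMap.zero_apply, map_zero]

/-- ★★ **THE RE-ISSUED `D2J` IS COVARIANT** for a covariant form letter and a covariant residual letter — `H₁`'s covariance at def-Y's tables of record is
def-Y's `H1Y_cov` (over `parSymY_isGaugeLawS`, `parBY_isGaugeLawB`, `GpY_isCovSiteOpY`). [cite: Balaban1985BackgroundPropagators, (3.156) p.428, (3.34) p.396, (3.129) p.421] -/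
theorem sectELettersYWithDt2_D2J_cov (x : MemberY d ℓ hd hL b₀ b₁ Mstar) (𝔯 : ResLettersY 𝔸 x) (hΔ : IsCovBondOpY x.toKIdx 𝔯.Δ2)
    (𝔡₂ : Dt2LettersY 𝔸 x.toKIdx) (hD : 𝔡₂.IsCov) (𝔢 : SectELettersY 𝔸 x) (g : GaugeY 𝔸 x.toKIdx) (U : CfgY 𝔸 x.toKIdx) :
    Intw (conjY (gIBondY x.toKIdx g)) (conjY (gIBondY x.toKIdx g)) ((sectELettersYWithDt2 𝔡 x 𝔯 𝔡₂ 𝔢).D2J U)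
      ((sectELettersYWithDt2 𝔡 x 𝔯 𝔡₂ 𝔢).D2J (gaugeY x.toKIdx g U)) := by
  have hS := parSymY_isGaugeLawS (𝔸 := 𝔸) x.toKIdx
  have hB := parBY_isGaugeLawB (𝔸 := 𝔸) x.toKIdx
  have hGp := GpY_isCovSiteOpY hS
  rw [sectELettersYWithDt2_D2J]
  exact d2JOfY_cov 𝔡 x.toKIdx _ _ _ _ 𝔡₂.form g U (H1Y_cov hS hB hGp hΔ) (hD g U)

variable {N : ℕ} (θ : Stage3Params) (Mstar' : ℕ)

/-- covariance of the family of form letters, member by member. [cite: Balaban1985BackgroundPropagators, (3.34) p.396, bookkeeping] -/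
def Dt2Y.IsCov (𝔡₂ : Dt2Y N θ Mstar') : Prop := ∀ x, (𝔡₂ x).IsCov

/-- the flat family is covariant. [cite: Balaban1985BackgroundPropagators, (3.34) p.396, bookkeeping] -/
theorem dt2Y_flat_isCov : (dt2Y_flat N θ Mstar').IsCov := fun x => dt2LettersY_flat_isCov x.toKIdx

/-- ★★ the record's re-issued `D2J` is covariant for a covariant residual family `𝔯` and covariant form letters `𝔡₂`.
[cite: Balaban1985BackgroundPropagators, (3.156) p.428, (3.34) p.396] -/
theorem sectEYWithDt2_D2J_cov (𝔯 : ResY N θ Mstar') (hΔ : ∀ x, IsCovBondOpY x.toKIdx (𝔯 x).Δ2) (𝔡₂ : Dt2Y N θ Mstar') (hD : 𝔡₂.IsCov)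
    (𝔢₀ : SectEY N θ Mstar') (x : MemberY θ.d₆ θ.ℓ₆ θ.hd' θ.hL' θ.b₀ θ.b₁ Mstar') (g : GaugeY (Matrix (Fin N) (Fin N) ℂ) x.toKIdx)
    (U : CfgY (Matrix (Fin N) (Fin N) ℂ) x.toKIdx) :
    Intw (conjY (gIBondY x.toKIdx g)) (conjY (gIBondY x.toKIdx g)) ((sectEYWithDt2 N θ Mstar' 𝔯 𝔡₂ 𝔢₀ x).D2J U)
      ((sectEYWithDt2 N θ Mstar' 𝔯 𝔡₂ 𝔢₀ x).D2J (gaugeY x.toKIdx g U)) :=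
  sectELettersYWithDt2_D2J_cov (trDualMatY N) x (𝔯 x) (hΔ x) (𝔡₂ x) (hD x) (𝔢₀ x) g U

/-- ★★★ **AT THE v8 RECORD (`𝔯 := resYOfC2 𝔠`) THE LETTER `D2J` IS GAUGE COVARIANT MODULO THE COVARIANCE OF THE TWO [5]-TYPE FORM LETTERS `𝔠`, `𝔡₂`**
(`Δ⁽²⁾`'s covariance is FILE 20's `resYOfC2_Δ2_isCovBondOpY`). [cite: Balaban1985BackgroundPropagators, (3.156) p.428, (3.134) p.422, (3.34) p.396] -/
theorem sectEYWithDt2_D2J_cov_ofC2 (𝔠 : C2Y N θ Mstar') (hC : 𝔠.IsCov) (𝔡₂ : Dt2Y N θ Mstar') (hD : 𝔡₂.IsCov) (𝔢₀ : SectEY N θ Mstar')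
    (x : MemberY θ.d₆ θ.ℓ₆ θ.hd' θ.hL' θ.b₀ θ.b₁ Mstar') (g : GaugeY (Matrix (Fin N) (Fin N) ℂ) x.toKIdx) (U : CfgY (Matrix (Fin N) (Fin N) ℂ) x.toKIdx) :
    Intw (conjY (gIBondY x.toKIdx g)) (conjY (gIBondY x.toKIdx g)) ((sectEYWithDt2 N θ Mstar' (resYOfC2 N θ Mstar' 𝔠) 𝔡₂ 𝔢₀ x).D2J U)
      ((sectEYWithDt2 N θ Mstar' (resYOfC2 N θ Mstar' 𝔠) 𝔡₂ 𝔢₀ x).D2J (gaugeY x.toKIdx g U)) :=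
  sectEYWithDt2_D2J_cov θ Mstar' _ (resYOfC2_Δ2_isCovBondOpY θ Mstar' 𝔠 hC) 𝔡₂ hD 𝔢₀ x g U

end Cov

/-! ## §7 `U = 1` units for the `G₁`-version of `QGQ*` (FILE 22's displayed `c1_inv` hypothesis at `U₁ = 1`; ref-E READ-26) -/

section UnitsAtOne

variable {d ℓ : ℕ} {hd : 1 ≤ d + 1} {hL : Odd (ℓ + 1) ∧ 1 < ℓ + 1} {b₀ b₁ : ℝ} {Mstar : ℕ}
variable {𝔸 : Type} [NormedRing 𝔸] [NormedAlgebra ℂ 𝔸] [CompleteSpace 𝔸]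
variable (i : KIdx d ℓ hd hL b₀ b₁) (parS : SiteParY 𝔸 i) (parB : BondParY 𝔸 i) (Gp : SiteOpY 𝔸 i)

/-- ★ **`(QG₁Q*)(1)` IS A UNIT** at tables with their `U = 1` clauses and a residual letter with `Δ⁽²⁾(1) = 0`: def-Y's `QGQOfY_G1Y_one` (`QG₁Q*(1) =
QGQ*(1)`) ▸ n06-i's `isUnit_QGQY_one` ([4] (2.35): «an inverse is a well-defined … operator»).  This is the witness for FILE 22's displayed hypothesis
`IsUnit (QGQOfY i parB (G1Y …) (cfg U₁))` of `QcoKH_G1_Qs_C1_eq_id` (`c1_inv`) AT `cfg U₁ = 1`; at a curved background it is (3.132)-sized (an estimate, not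
claimed). [cite: Balaban1985BackgroundPropagators, (3.132) p.422, (3.127) p.421, Cor. 3.5 p.407; Balaban1984PropagatorsII, (2.35) p.228] -/
theorem isUnit_QGQOfY_G1Y_one (hparS : ∀ z w, parS (fun _ _ => 1) z w = 1) (hparB : ∀ s s', parB (fun _ _ => 1) s s' = 1)
    (hGp : ∀ (f : SiteY i → ℝ) (E : 𝔸), Gp (fun _ _ => 1) (liftY f E) = liftY ((toKT i).G *ᵥ f) E) {Δ2 : BondOpY 𝔸 i}
    (hΔ : Δ2 (fun _ _ => 1) = 0) :
    IsUnit (QGQOfY i parB (G1Y i parS parB Gp Δ2) (fun _ _ => 1)) := by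
  rw [QGQOfY_G1Y_one i parS parB Gp hΔ]
  exact isUnit_QGQY_one i hparS hparB hGp

/-- ★ **`(QG₁Q*)(1)` IS A UNIT AT THE TABLES OF RECORD** (`parSymY`, `parBY`, `GpY parSymY`) over ANY residual letter `𝔯` (its clause `𝔯.Δ2_one`).
[cite: Balaban1985BackgroundPropagators, (3.132) p.422, Cor. 3.5 p.407; Balaban1984PropagatorsII, (2.35) p.228] -/
theorem isUnit_QGQOfY_G1Y_record_one (x : MemberY d ℓ hd hL b₀ b₁ Mstar) (𝔯 : ResLettersY 𝔸 x) :
    IsUnit (QGQOfY x.toKIdx (parBY x.toKIdx)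
      (G1Y x.toKIdx (parSymY x.toKIdx) (parBY x.toKIdx) (GpY x.toKIdx (parSymY x.toKIdx)) 𝔯.Δ2) (fun _ _ => 1)) :=
  isUnit_QGQOfY_G1Y_one x.toKIdx _ _ _ (fun z w => parSymY_one x.toKIdx z w) (fun s s' => parBY_one x.toKIdx s s')
    (fun f E => GpY_one_liftY x.toKIdx (parSymY x.toKIdx) (fun z w => parSymY_one x.toKIdx z w) f E) 𝔯.Δ2_one

variable (N : ℕ) (θ : Stage3Params) (Mstar' : ℕ) (𝔯 : ResY N θ Mstar')

/-- ★ the same for the v4 letters of record: `IsUnit (Q G₁ Q*)(1)` with `G₁ := (lettersYOfRecordV4 N θ M⋆ 𝔯 x).G₁` and the record's `Q ∕ Q*` (`parBY`).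
[cite: Balaban1985BackgroundPropagators, (3.132) p.422, (3.129) p.421, bookkeeping] -/
theorem isUnit_QGQOfY_lettersYOfRecordV4_G₁_one (x : MemberY θ.d₆ θ.ℓ₆ θ.hd' θ.hL' θ.b₀ θ.b₁ Mstar') :
    IsUnit (QGQOfY x.toKIdx (parBY x.toKIdx) (lettersYOfRecordV4 N θ Mstar' 𝔯 x).G₁ (fun _ _ => 1)) :=
  isUnit_QGQOfY_G1Y_record_one x (𝔯 x)

end UnitsAtOne

end Literature.MathematicalPhysics.QuantumFieldTheory.Balaban1983to89.Node00

end
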